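import Summits.Ventures.PercRepro.S2ContractionCaps
import Summits.Ventures.PercRepro.S2ContractionTriples
import Summits.Ventures.PercRepro.RankLevelSetPlaneSix

/-!
# PercRepro — S2: TWO COUNTS FOR THE CASE `ν = 4` OF THE ROW `p = 13` (p7, gen 17; sub-claim S2)

**`ncard_dep_four_le_ncard_indep_three`** — inside any `W ⊆ E` of an `e`-free core the dependent `4`-subsets number at most the
independent `3`-subsets: a dependent `4`-set has rank `3` (no `4`-set has rank `≤ 2` when lines carry `≤ 3` points), so at most one
of its four `3`-subsets is dependent (two dependent triples of a `4`-set share a pair `{u, v}` and put the whole set inside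
`cl {u, v}`), i.e. it contains `≥ 3` independent triples; an independent triple `T` lies in at most `3` dependent `4`-subsets
`T ∪ {x}` (`x ∈ cl T ∖ T`, and the plane `cl T` has `≤ 6` points: `ThmN.ncard_le_six_of_eRk_le_three_of_free`).
**`ncard_allpairs_dep_three_le_four`** — in a loopless matroid with `≤ 6` dependent pairs, the `3`-sets all of whose pairs are
dependent number `≤ 4`: a dependent pair `{x, y}` lies in at most `2` such triples, since the points `z` completing it are pairwise
dependent with `x` and `y` and with each other (submodularity on `{x, z}`, `{x, z'}` through the nonloop `x`), so `{x, y} ∪ Z` has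
`C(|{x, y} ∪ Z|, 2) ≤ 6` dependent pairs and `|Z| ≤ 2`; `3 · #triples ≤ 2 · #pairs ≤ 12`. The kit's bounds were `C(|W|, 4)` and
`6·(|E| − 2)/3 = 18`. Axioms: standard.
-/

open scoped Matroid

namespace PercRepro

namespace S2

open Set

variable {α : Type}

/-- **The dependent `4`-subsets of `W` against its independent `3`-subsets** (lines `≤ 3` points, planes `≤ 6` points). -/
theorem ncard_dep_four_le_ncard_indep_three (M : Matroid α) [M.Finite]
    (hfree : ∀ e ∈ M.E, ∃ A ⊆ M.E \ {e}, e ∉ M.closure A ∧ e ∉ M.closure ((M.E \ {e}) \ A))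
    (hs : ∀ e ∈ M.E, ∀ f ∈ M.E, e ≠ f → M.eRk {e, f} = 2)
    (hC1 : ∀ L ⊆ M.E, M.eRk L = 2 → L.ncard ≤ 3) {W : Set α} (hW : W ⊆ M.E) :
    {Q : Set α | Q ⊆ W ∧ Q.ncard = 4 ∧ M.Dep Q}.ncard ≤ {T : Set α | T ⊆ W ∧ T.ncard = 3 ∧ M.Indep T}.ncard := by
  classical
  have hEfin := M.ground_finite
  have hWfin : W.Finite := hEfin.subset hW
  set Wf : Finset α := hWfin.toFinset with hWf
  have hWfc : (Wf : Set α) = W := Set.Finite.coe_toFinset _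
  set s : Finset (Set α) := (Matroid.subsF Wf 4).filter (fun Q => M.Dep Q) with hsdef
  set t : Finset (Set α) := (Matroid.subsF Wf 3).filter (fun T => M.Indep T) with htdef
  have hmem_s : ∀ Q, Q ∈ s ↔ Q ⊆ W ∧ Q.ncard = 4 ∧ M.Dep Q := by
    intro Q
    rw [hsdef, Finset.mem_filter, mem_subsF_iff, hWfc]
    tauto
  have hmem_t : ∀ T, T ∈ t ↔ T ⊆ W ∧ T.ncard = 3 ∧ M.Indep T := by
    intro T
    rw [htdef, Finset.mem_filter, mem_subsF_iff, hWfc]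
    tauto
  have hcard_s : {Q : Set α | Q ⊆ W ∧ Q.ncard = 4 ∧ M.Dep Q}.ncard = s.card := by
    rw [← Set.ncard_coe_finset s]
    congr 1
    ext Q
    rw [Finset.mem_coe, hmem_s]
    rfl
  have hcard_t : {T : Set α | T ⊆ W ∧ T.ncard = 3 ∧ M.Indep T}.ncard = t.card := by
    rw [← Set.ncard_coe_finset t]
    congr 1
    ext T
    rw [Finset.mem_coe, hmem_t]
    rfl
  rw [hcard_s, hcard_t]
  have h := Finset.card_mul_le_card_mul (fun (Q : Set α) (T : Set α) => T ⊆ Q) (s := s) (t := t) (m := 3) (n := 3) ?_ ?_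
  · omega
  · -- a dependent `4`-set of `W` has `≥ 3` independent triples: its rank is `3` and at most one triple is dependent
    intro Q hQ
    obtain ⟨hQW, hQ4, hQdep⟩ := (hmem_s Q).1 hQ
    have hQE : Q ⊆ M.E := hQW.trans hW
    have hQfin : Q.Finite := hEfin.subset hQE
    have hr3 : ¬ M.eRk Q ≤ 2 := by
      intro hle
      have h0 := ncard_four_eRk_le_two_eq_zero M hs hC1 hW
      rw [Set.ncard_eq_zero (hEfin.finite_subsets.subset (fun T hT => hT.1.trans hW))] at h0
      exact Set.eq_empty_iff_forall_notMem.1 h0 Q ⟨hQW, hQ4, hle⟩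
    -- the dependent triples inside `Q` number `≤ 1`
    have hdep1 : {T : Set α | T ⊆ Q ∧ T.ncard = 3 ∧ M.Dep T}.ncard ≤ 1 := by
      rw [Set.ncard_le_one_iff (hQfin.finite_subsets.subset (fun T hT => hT.1))]
      rintro T₁ T₂ ⟨hT₁Q, hT₁3, hT₁dep⟩ ⟨hT₂Q, hT₂3, hT₂dep⟩
      by_contra hne
      have hT₁fin : T₁.Finite := hQfin.subset hT₁Q
      have hT₂fin : T₂.Finite := hQfin.subset hT₂Q
      have hU : (T₁ ∪ T₂).ncard ≤ 4 := hQ4 ▸ Set.ncard_le_ncard (Set.union_subset hT₁Q hT₂Q) hQfin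
      have hUI := Set.ncard_union_add_ncard_inter T₁ T₂ hT₁fin hT₂fin
      have hI2 : (T₁ ∩ T₂).ncard ≤ 2 := by
        by_contra hlt
        push Not at hlt
        have hle : T₁.ncard ≤ (T₁ ∩ T₂).ncard := by omega
        have heq : T₁ ∩ T₂ = T₁ := Set.eq_of_subset_of_ncard_le Set.inter_subset_left hle hT₁fin
        have hsub : T₁ ⊆ T₂ := by rw [← heq]; exact Set.inter_subset_right
        exact hne (Set.eq_of_subset_of_ncard_le hsub (by omega) hT₂fin)
      have hI2' : (T₁ ∩ T₂).ncard = 2 := by omega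
      obtain ⟨u, v, huv, hpair⟩ := Set.ncard_eq_two.1 hI2'
      have hu : u ∈ T₁ ∩ T₂ := by rw [hpair]; exact Set.mem_insert u _
      have hv : v ∈ T₁ ∩ T₂ := by rw [hpair]; exact Set.mem_insert_of_mem u rfl
      have hc₁ := subset_closure_pair_of_dep_three M hs (hT₁Q.trans hQE) hT₁3 hT₁dep hu.1 hv.1 huv
      have hc₂ := subset_closure_pair_of_dep_three M hs (hT₂Q.trans hQE) hT₂3 hT₂dep hu.2 hv.2 huv
      have hQeq : T₁ ∪ T₂ = Q := Set.eq_of_subset_of_ncard_le (Set.union_subset hT₁Q hT₂Q) (by omega) hQfin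
      have hQcl : Q ⊆ M.closure {u, v} := hQeq ▸ Set.union_subset hc₁ hc₂
      apply hr3
      calc M.eRk Q ≤ M.eRk (M.closure {u, v}) := M.eRk_mono hQcl
        _ = M.eRk {u, v} := M.eRk_closure_eq _
        _ = 2 := hs u (hQE (hT₁Q hu.1)) v (hQE (hT₁Q hv.1)) huv
    have hall : {T : Set α | T ⊆ Q ∧ T.ncard = 3}.ncard = 4 := by
      rw [ncard_subsets_ncard_eq Q hQfin 3, hQ4]
      norm_num [Nat.choose]
    have hsplit : {T : Set α | T ⊆ Q ∧ T.ncard = 3}.ncard ≤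
        {T : Set α | T ⊆ Q ∧ T.ncard = 3 ∧ M.Indep T}.ncard + {T : Set α | T ⊆ Q ∧ T.ncard = 3 ∧ M.Dep T}.ncard := by
      refine le_trans (Set.ncard_le_ncard ?_ ((hQfin.finite_subsets.subset (fun T hT => hT.1)).union
        (hQfin.finite_subsets.subset (fun T hT => hT.1)))) (Set.ncard_union_le _ _)
      rintro T ⟨hTQ, hT3⟩
      by_cases hind : M.Indep T
      · exact Or.inl ⟨hTQ, hT3, hind⟩
      · exact Or.inr ⟨hTQ, hT3, M.dep_iff.2 ⟨hind, hTQ.trans hQE⟩⟩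
    -- the independent triples of `Q` lie below `Q`
    have hsub : {T : Set α | T ⊆ Q ∧ T.ncard = 3 ∧ M.Indep T} ⊆
        ((t.bipartiteAbove (fun (Q : Set α) (T : Set α) => T ⊆ Q) Q : Finset (Set α)) : Set (Set α)) := by
      rintro T ⟨hTQ, hT3, hTind⟩
      rw [Finset.mem_coe, Finset.mem_bipartiteAbove, hmem_t]
      exact ⟨⟨hTQ.trans hQW, hT3, hTind⟩, hTQ⟩
    have h3 := Set.ncard_le_ncard hsub (Finset.finite_toSet _)
    rw [Set.ncard_coe_finset] at h3
    omega
  · -- an independent triple lies in at most `3` dependent `4`-subsets of `W`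
    intro T hT
    obtain ⟨hTW, hT3, hTind⟩ := (hmem_t T).1 hT
    have hTE : T ⊆ M.E := hTW.trans hW
    have hTfin : T.Finite := hEfin.subset hTE
    -- the plane `cl T` has `≤ 6` points
    have hcl : M.closure T ⊆ M.E := M.closure_subset_ground T
    have hr : M.eRk (M.closure T) ≤ 3 := by
      rw [M.eRk_closure_eq, hTind.eRk_eq_encard, ← hTfin.cast_ncard_eq, hT3]
      exact le_rfl
    have h6 := ThmN.ncard_le_six_of_eRk_le_three_of_free M hfree hcl hr
    have hclfin : (M.closure T).Finite := hEfin.subset hcl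
    have hTcl : T ⊆ M.closure T := M.subset_closure T hTE
    have hX3 : (M.closure T \ T).ncard ≤ 3 := by
      have := Set.ncard_sdiff_add_ncard_of_subset hTcl hclfin
      omega
    -- the `4`-sets above `T` inject into the points of `cl T ∖ T`
    have hsub : ((s.bipartiteBelow (fun (Q : Set α) (T : Set α) => T ⊆ Q) T : Finset (Set α)) : Set (Set α)) ⊆
        {Q : Set α | Q ⊆ M.closure T ∧ Q.ncard = 4 ∧ T ⊆ Q} := by
      intro Q hQ
      rw [Finset.mem_coe, Finset.mem_bipartiteBelow] at hQ
      obtain ⟨hQs, hTQ⟩ := hQ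
      obtain ⟨hQW, hQ4, hQdep⟩ := (hmem_s Q).1 hQs
      refine ⟨?_, hQ4, hTQ⟩
      -- `Q = T ∪ {x}` is dependent with `T` independent: `x ∈ cl T`
      intro x hx
      by_cases hxT : x ∈ T
      · exact hTcl hxT
      by_contra hxcl
      have hxE : x ∈ M.E := hW (hQW hx)
      have hQeq : Q = insert x T := by
        refine (Set.eq_of_subset_of_ncard_le (Set.insert_subset hx hTQ) ?_ (hEfin.subset (hQW.trans hW))).symm
        rw [Set.ncard_insert_of_notMem hxT hTfin, hT3, hQ4]
      have hind : M.Indep (insert x T) := hTind.insert_indep_iff_of_notMem hxT |>.2 ⟨hxE, hxcl⟩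
      rw [hQeq] at hQdep
      exact hQdep.not_indep hind
    have h := Set.ncard_le_ncard hsub (hclfin.finite_subsets.subset (fun Q hQ => hQ.1))
    rw [Set.ncard_coe_finset] at h
    refine h.trans ?_
    -- `Q ↦ Q ∖ T` into the `1`-subsets of `cl T ∖ T`
    have hinj : {Q : Set α | Q ⊆ M.closure T ∧ Q.ncard = 4 ∧ T ⊆ Q}.ncard ≤
        {X : Set α | X ⊆ M.closure T \ T ∧ X.ncard = 1}.ncard := by
      refine Set.ncard_le_ncard_of_injOn (fun Q => Q \ T) ?_ ?_ ((hclfin.sdiff).finite_subsets.subset (fun X hX => hX.1))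
      · rintro Q ⟨hQcl, hQ4, hTQ⟩
        refine ⟨Set.sdiff_subset_sdiff_left hQcl, ?_⟩
        rw [Set.ncard_sdiff hTQ hTfin, hQ4, hT3]
      · rintro Q₁ ⟨-, -, h1⟩ Q₂ ⟨-, -, h2⟩ hEq
        have e1 := Set.union_sdiff_cancel h1
        have e2 := Set.union_sdiff_cancel h2
        simp only at hEq
        rw [← e1, ← e2, hEq]
    refine hinj.trans ?_
    rw [ncard_subsets_ncard_eq _ hclfin.sdiff 1, Nat.choose_one_right]
    exact hX3

/-- **The `3`-sets all of whose pairs are dependent, in a loopless matroid with `≤ 6` dependent pairs: at most `4`.** -/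
theorem ncard_allpairs_dep_three_le_four (N : Matroid α) [N.Finite] (hL : ∀ e ∈ N.E, ¬ N.IsLoop e)
    (hD2 : {P : Set α | P ⊆ N.E ∧ P.ncard = 2 ∧ N.Dep P}.ncard ≤ 6) :
    {X : Set α | X ⊆ N.E ∧ X.ncard = 3 ∧ ∀ x ∈ X, ∀ y ∈ X, x ≠ y → N.Dep {x, y}}.ncard ≤ 4 := by
  classical
  have hEfin : N.E.Finite := N.ground_finite
  set Ef : Finset α := hEfin.toFinset with hEf
  have hEfc : (Ef : Set α) = N.E := Set.Finite.coe_toFinset _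
  set s : Finset (Set α) := (Matroid.subsF Ef 3).filter (fun X => ∀ x ∈ X, ∀ y ∈ X, x ≠ y → N.Dep {x, y}) with hsdef
  set t : Finset (Set α) := (Matroid.subsF Ef 2).filter (fun P => N.Dep P) with htdef
  have hmem_s : ∀ X, X ∈ s ↔ X ⊆ N.E ∧ X.ncard = 3 ∧ ∀ x ∈ X, ∀ y ∈ X, x ≠ y → N.Dep {x, y} := by
    intro X
    rw [hsdef, Finset.mem_filter, mem_subsF_iff, hEfc]
    tauto
  have hmem_t : ∀ P, P ∈ t ↔ P ⊆ N.E ∧ P.ncard = 2 ∧ N.Dep P := by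
    intro P
    rw [htdef, Finset.mem_filter, mem_subsF_iff, hEfc]
    tauto
  have hcard_s : {X : Set α | X ⊆ N.E ∧ X.ncard = 3 ∧ ∀ x ∈ X, ∀ y ∈ X, x ≠ y → N.Dep {x, y}}.ncard = s.card := by
    rw [← Set.ncard_coe_finset s]
    congr 1
    ext X
    rw [Finset.mem_coe, hmem_s]
    rfl
  have hcard_t : {P : Set α | P ⊆ N.E ∧ P.ncard = 2 ∧ N.Dep P}.ncard = t.card := by
    rw [← Set.ncard_coe_finset t]
    congr 1
    ext P
    rw [Finset.mem_coe, hmem_t]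
    rfl
  rw [hcard_s]
  rw [hcard_t] at hD2
  -- two dependent pairs through a nonloop `x` make a dependent pair
  have hdep_trans : ∀ x ∈ N.E, ∀ z z', z ≠ x → z' ≠ x → z ≠ z' → N.Dep {x, z} → N.Dep {x, z'} → N.Dep {z, z'} := by
    intro x hx z z' hzx hz'x hzz' h1 h2
    have hzE : z ∈ N.E := h1.subset_ground (Set.mem_insert_of_mem x rfl)
    have hz'E : z' ∈ N.E := h2.subset_ground (Set.mem_insert_of_mem x rfl)
    have r1 : N.eRk {x, z} ≤ 1 := by
      have h := (Matroid.eRk_lt_encard_iff_dep_of_finite (Set.toFinite _) h1.subset_ground).2 h1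
      rw [Set.encard_pair hzx.symm] at h
      exact Order.le_of_lt_add_one h
    have r2 : N.eRk {x, z'} ≤ 1 := by
      have h := (Matroid.eRk_lt_encard_iff_dep_of_finite (Set.toFinite _) h2.subset_ground).2 h2
      rw [Set.encard_pair hz'x.symm] at h
      exact Order.le_of_lt_add_one h
    have hx1 : N.eRk {x} = 1 := (Matroid.isNonloop_of_not_isLoop hx (hL x hx)).eRk_eq
    have hsub := N.eRk_inter_add_eRk_union_le {x, z} {x, z'}
    have hinter : ({x, z} : Set α) ∩ {x, z'} = {x} := by
      ext w
      simp only [Set.mem_inter_iff, Set.mem_insert_iff, Set.mem_singleton_iff]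
      constructor
      · rintro ⟨h | h, h' | h'⟩
        · exact h
        · exact h
        · exact h'
        · exact absurd (h.symm.trans h') hzz'
      · rintro rfl; exact ⟨Or.inl rfl, Or.inl rfl⟩
    rw [hinter, hx1] at hsub
    have hU : N.eRk ({x, z} ∪ {x, z'}) ≤ 1 := by
      have : N.eRk ({x, z} ∪ {x, z'}) + 1 ≤ 1 + 1 := by
        calc N.eRk ({x, z} ∪ {x, z'}) + 1 = 1 + N.eRk ({x, z} ∪ {x, z'}) := add_comm _ _
          _ ≤ N.eRk {x, z} + N.eRk {x, z'} := hsub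
          _ ≤ 1 + 1 := add_le_add r1 r2
      exact (ENat.add_le_add_iff_right (by simp)).1 this
    have hzz'sub : ({z, z'} : Set α) ⊆ {x, z} ∪ {x, z'} := by
      rintro w (rfl | rfl)
      · exact Or.inl (Set.mem_insert_of_mem x rfl)
      · exact Or.inr (Set.mem_insert_of_mem x rfl)
    rw [← Matroid.eRk_lt_encard_iff_dep_of_finite (Set.toFinite _) (Set.pair_subset hzE hz'E), Set.encard_pair hzz']
    calc N.eRk {z, z'} ≤ N.eRk ({x, z} ∪ {x, z'}) := N.eRk_mono hzz'sub
      _ ≤ 1 := hU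
      _ < 2 := by norm_num
  have h := Finset.card_mul_le_card_mul (fun (X : Set α) (P : Set α) => P ⊆ X) (s := s) (t := t) (m := 3) (n := 2) ?_ ?_
  · omega
  · -- each triple has three dependent pairs below it (as in `ncard_allpairs_dep_three_mul_three_le`)
    intro X hX
    obtain ⟨hXE, hX3, hpairs⟩ := (hmem_s X).1 hX
    obtain ⟨a, b, c, hab, hac, hbc, rfl⟩ := Set.ncard_eq_three.1 hX3
    have hpair : ∀ {u v : α}, u ∈ ({a, b, c} : Set α) → v ∈ ({a, b, c} : Set α) → u ≠ v →
        ({u, v} : Set α) ∈ t.bipartiteAbove (fun (X : Set α) (P : Set α) => P ⊆ X) {a, b, c} := by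
      intro u v hu hv huv
      rw [Finset.mem_bipartiteAbove, hmem_t]
      exact ⟨⟨(Set.pair_subset hu hv).trans hXE, Set.ncard_pair huv, hpairs u hu v hv huv⟩, Set.pair_subset hu hv⟩
    have h1 := hpair (Set.mem_insert a _) (Set.mem_insert_of_mem a (Set.mem_insert b _)) hab
    have h2 := hpair (Set.mem_insert a _) (Set.mem_insert_of_mem a (Set.mem_insert_of_mem b rfl)) hac
    have h3 := hpair (Set.mem_insert_of_mem a (Set.mem_insert b _)) (Set.mem_insert_of_mem a (Set.mem_insert_of_mem b rfl)) hbc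
    have hne12 : ({a, b} : Set α) ≠ {a, c} := fun h => hbc (by
      have : b ∈ ({a, c} : Set α) := h ▸ Set.mem_insert_of_mem a rfl
      rcases this with h' | h'
      · exact absurd h' hab.symm
      · exact h')
    have hne13 : ({a, b} : Set α) ≠ {b, c} := fun h => hac (by
      have : a ∈ ({b, c} : Set α) := h ▸ Set.mem_insert a _
      rcases this with h' | h'
      · exact absurd h' hab
      · exact h')
    have hne23 : ({a, c} : Set α) ≠ {b, c} := fun h => hab (by
      have : a ∈ ({b, c} : Set α) := h ▸ Set.mem_insert a _
      rcases this with h' | h'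
      · exact h'
      · exact absurd h' hac)
    calc 3 = ({({a, b} : Set α), {a, c}, {b, c}} : Finset (Set α)).card := by
          rw [Finset.card_insert_of_notMem, Finset.card_pair hne23]
          simp only [Finset.mem_insert, Finset.mem_singleton, not_or]
          exact ⟨hne12, hne13⟩
      _ ≤ _ := Finset.card_le_card (by
          intro P hP
          simp only [Finset.mem_insert, Finset.mem_singleton] at hP
          rcases hP with rfl | rfl | rfl
          · exact h1
          · exact h2
          · exact h3)
  · -- a dependent pair `{x, y}` lies in at most `2` such triples
    intro P hP
    obtain ⟨hPE, hP2, hPdep⟩ := (hmem_t P).1 hP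
    obtain ⟨x, y, hxy, rfl⟩ := Set.ncard_eq_two.1 hP2
    have hxE : x ∈ N.E := hPE (Set.mem_insert x _)
    have hyE : y ∈ N.E := hPE (Set.mem_insert_of_mem x rfl)
    -- the completing points
    set Z : Set α := {z | z ∈ N.E ∧ z ≠ x ∧ z ≠ y ∧ N.Dep {x, z} ∧ N.Dep {y, z}} with hZ
    have hZfin : Z.Finite := hEfin.subset (fun z hz => hz.1)
    -- `{x, y} ∪ Z` has all its pairs dependent, hence `C(|{x, y} ∪ Z|, 2) ≤ 6` and `|Z| ≤ 2`
    have hC : {Q : Set α | Q ⊆ {x, y} ∪ Z ∧ Q.ncard = 2} ⊆ {Q : Set α | Q ⊆ N.E ∧ Q.ncard = 2 ∧ N.Dep Q} := by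
      rintro Q ⟨hQsub, hQ2⟩
      obtain ⟨u, v, huv, rfl⟩ := Set.ncard_eq_two.1 hQ2
      have hu := hQsub (Set.mem_insert u _)
      have hv := hQsub (Set.mem_insert_of_mem u rfl)
      have hCE : ({x, y} ∪ Z : Set α) ⊆ N.E := Set.union_subset hPE (fun z hz => hz.1)
      refine ⟨Set.pair_subset (hCE hu) (hCE hv), Set.ncard_pair huv, ?_⟩
      -- the four kinds of pair
      have key : ∀ {u v : α}, u ∈ ({x, y} ∪ Z : Set α) → v ∈ ({x, y} ∪ Z : Set α) → u ≠ v → N.Dep {u, v} := by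
        intro u v hu hv huv
        have hsymm : ∀ {a b : α}, N.Dep {a, b} → N.Dep {b, a} := fun h => by rwa [Set.pair_comm]
        rcases hu with (rfl | rfl) | hu <;> rcases hv with (rfl | rfl) | hv
        · exact absurd rfl huv
        · exact hPdep
        · exact hv.2.2.2.1
        · exact hsymm hPdep
        · exact absurd rfl huv
        · exact hv.2.2.2.2
        · exact hsymm hu.2.2.2.1
        · exact hsymm hu.2.2.2.2
        · exact hdep_trans x hxE u v hu.2.1 hv.2.1 huv hu.2.2.2.1 hv.2.2.2.1
      exact key hu hv huv
    have hCcard := Set.ncard_le_ncard hC (hEfin.finite_subsets.subset (fun Q hQ => hQ.1))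
    rw [ncard_subsets_ncard_eq _ ((Set.toFinite _).union hZfin) 2] at hCcard
    have hdisj : Disjoint ({x, y} : Set α) Z := by
      rw [Set.disjoint_left]
      rintro z (rfl | rfl) hz
      · exact hz.2.1 rfl
      · exact hz.2.2.1 rfl
    rw [Set.ncard_union_eq hdisj (Set.toFinite _) hZfin, Set.ncard_pair hxy] at hCcard
    have hZ2 : Z.ncard ≤ 2 := by
      by_contra hlt
      push Not at hlt
      have h5 : (5 : ℕ).choose 2 ≤ (2 + Z.ncard).choose 2 := Nat.choose_le_choose 2 (by omega)
      norm_num [Nat.choose] at h5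
      omega
    -- the triples above `{x, y}` inject into the `1`-subsets of `Z`
    have hsub : ((s.bipartiteBelow (fun (X : Set α) (P : Set α) => P ⊆ X) {x, y} : Finset (Set α)) : Set (Set α)) ⊆
        {X : Set α | X ⊆ N.E ∧ X.ncard = 3 ∧ {x, y} ⊆ X ∧ ∀ u ∈ X, ∀ v ∈ X, u ≠ v → N.Dep {u, v}} := by
      intro X hX
      rw [Finset.mem_coe, Finset.mem_bipartiteBelow] at hX
      obtain ⟨hXs, hPX⟩ := hX
      obtain ⟨hXE, hX3, hpairs⟩ := (hmem_s X).1 hXs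
      exact ⟨hXE, hX3, hPX, hpairs⟩
    have h := Set.ncard_le_ncard hsub (hEfin.finite_subsets.subset (fun X hX => hX.1))
    rw [Set.ncard_coe_finset] at h
    refine h.trans ?_
    have hinj : {X : Set α | X ⊆ N.E ∧ X.ncard = 3 ∧ {x, y} ⊆ X ∧ ∀ u ∈ X, ∀ v ∈ X, u ≠ v → N.Dep {u, v}}.ncard ≤
        {Y : Set α | Y ⊆ Z ∧ Y.ncard = 1}.ncard := by
      refine Set.ncard_le_ncard_of_injOn (fun X => X \ {x, y}) ?_ ?_ (hZfin.finite_subsets.subset (fun Y hY => hY.1))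
      · rintro X ⟨hXE, hX3, hPX, hpairs⟩
        refine ⟨?_, ?_⟩
        · rintro z ⟨hzX, hzP⟩
          simp only [Set.mem_insert_iff, Set.mem_singleton_iff, not_or] at hzP
          exact ⟨hXE hzX, hzP.1, hzP.2, hpairs x (hPX (Set.mem_insert x _)) z hzX (Ne.symm hzP.1),
            hpairs y (hPX (Set.mem_insert_of_mem x rfl)) z hzX (Ne.symm hzP.2)⟩
        · rw [Set.ncard_sdiff hPX (Set.toFinite _), hX3, Set.ncard_pair hxy]
      · rintro X₁ ⟨-, -, h1, -⟩ X₂ ⟨-, -, h2, -⟩ hEq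
        have e1 := Set.union_sdiff_cancel h1
        have e2 := Set.union_sdiff_cancel h2
        simp only at hEq
        rw [← e1, ← e2, hEq]
    refine hinj.trans ?_
    rw [ncard_subsets_ncard_eq Z hZfin 1, Nat.choose_one_right]
    exact hZ2

end S2

end PercRepro
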